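import Literature.AlgebraicGeometry.Motives.GrassmannianZariskiGluing
import Mathlib.AlgebraicGeometry.AffineScheme
import HarnessLib

/-!
# Gluing Grassmannian elements along basic open covers of an affine open of a scheme

Topic `AlgebraicGeometry/Motives`; namespace `Literature.AlgebraicGeometry.Motives.Grassmannian`.
THEOREMS ONLY (no definition, no named fact, no instance, no `sorry`).

[GortzWedhorn2020, (8.4) pp. 213–215 and (8.6) p. 217]: the Grassmannian functor is a Zariski sheaf.  ★ `GrassmannianZariskiGluing`
(`existsUnique_map_eq_of_map_eq`) proves the affine gluing statement for Mathlib's `Module.Grassmannian.map` in commutative-algebra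
vocabulary (abstract `IsLocalization.Away` models of the pieces and of the double overlaps).  This file RESTATES IT IN SCHEME
VOCABULARY, the form in which the promotion of `Module.Grassmannian.functor` to a presheaf on `Scheme` consumes it: for an affine
open `U` of a scheme `X`, a finite set `s ⊆ Γ(X, U)` generating the unit ideal (equivalently `U = ⋃_{f ∈ s} D(f)`), and an abelian
group `M`, Grassmannian elements `N_f ∈ G(k, Γ(X, D(f)) ⊗_ℤ M; Γ(X, D(f)))` whose restrictions to `Γ(X, D(fg))` agree come from
EXACTLY ONE `N ∈ G(k, Γ(X, U) ⊗_ℤ M; Γ(X, U))`.  All maps are restriction maps of the structure sheaf, viewed as `ℤ`-algebra maps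
(`RingHom.toIntAlgHom`); the localization hypotheses of ★ `existsUnique_map_eq_of_map_eq` are discharged by Mathlib's
`IsAffineOpen.isLocalization_basicOpen` / `isLocalization_of_eq_basicOpen` and `Scheme.basicOpen_mul`, `Scheme.basicOpen_res`.

* §1 (private) `map_res_comp` — functoriality of `Module.Grassmannian.map` along two successive restrictions;
* §2 **`existsUnique_map_eq_of_map_eq_basicOpen`** — the gluing statement above;
  `eq_of_forall_map_basicOpen_eq` — two elements over `U` with the same restrictions to every `D(f)`, `f ∈ s`, are equal.

Cell `hodgecm-mathlib` (D-0151), F-DAG first hand (h4) «Grassmannian as a scheme» (B-p21 (g15) author; B-p18 (g17) charts,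
B-p09 (g12) openness), count-neutral Mathlib-side capital (brick (A1′)).  Nothing here is about HC; HC_CM is proved only modulo the
7 printed citations until rung 0 closes.

## References
* [GortzWedhorn2020] U. Görtz, T. Wedhorn, *Algebraic Geometry I*, 2nd ed. (2020), (8.4) (pp. 213–215) and (8.6) (p. 217).
* [StacksProject] The Stacks project, Tag 089R (Grassmannians) and Tag 01HR (basic opens of affine schemes).
-/

namespace Literature.AlgebraicGeometry.Motives.Grassmannian

open _root_.AlgebraicGeometry _root_.CategoryTheory Opposite TensorProduct

universe u v

variable {X : Scheme.{u}} {M : Type v} [AddCommGroup M] {k : ℕ}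

/-! ## §1 Restriction maps and `Module.Grassmannian.map` -/

/-- Functoriality of `Module.Grassmannian.map` along two successive restriction maps `Γ(X, U) → Γ(X, V) → Γ(X, W)` of the
structure sheaf (`W ≤ V ≤ U`), all viewed as `ℤ`-algebra maps. [folklore] -/
private theorem map_res_comp {U V W : X.Opens} (hVU : V ≤ U) (hWV : W ≤ V)
    (N : Module.Grassmannian Γ(X, U) (Γ(X, U) ⊗[ℤ] M) k) :
    Module.Grassmannian.map (X.presheaf.map (homOfLE hWV).op).hom.toIntAlgHom
        (Module.Grassmannian.map (X.presheaf.map (homOfLE hVU).op).hom.toIntAlgHom N) =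
      Module.Grassmannian.map (X.presheaf.map (homOfLE (hWV.trans hVU)).op).hom.toIntAlgHom N := by
  rw [← Module.Grassmannian.map_comp]
  congr 1
  apply AlgHom.ext
  intro x
  change (X.presheaf.map (homOfLE hVU).op ≫ X.presheaf.map (homOfLE hWV).op) x = _
  rw [← X.presheaf.map_comp]
  rfl

/-! ## §2 Gluing along a basic open cover of an affine open -/

section Gluing

variable {U : X.Opens} (hU : IsAffineOpen U) (s : Set Γ(X, U)) [Finite s] (hs : Ideal.span s = ⊤)

/-- `D(fg) ≤ D(f)`. [folklore] -/
private theorem basicOpen_mul_le_left (f g : Γ(X, U)) : X.basicOpen (f * g) ≤ X.basicOpen f :=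
  (X.basicOpen_mul f g).le.trans inf_le_left

/-- `D(fg) ≤ D(g)`. [folklore] -/
private theorem basicOpen_mul_le_right (f g : Γ(X, U)) : X.basicOpen (f * g) ≤ X.basicOpen g :=
  (X.basicOpen_mul f g).le.trans inf_le_right

include hU hs in
/-- **GLUING IN THE GRASSMANNIAN FUNCTOR along a basic open cover of an affine open.**  Let `U` be an affine open of the
scheme `X`, `s ⊆ Γ(X, U)` a finite set generating the unit ideal (so `U = ⋃_{f ∈ s} D(f)`), `M` an abelian group.  Given
`N_f ∈ G(k, Γ(X, D(f)) ⊗_ℤ M; Γ(X, D(f)))` for `f ∈ s` such that, for all `f, g ∈ s`, the restrictions of `N_f` and `N_g` to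
`Γ(X, D(fg))` (`D(fg) = D(f) ∩ D(g)`) agree — restriction = `Module.Grassmannian.map` of the restriction map of `𝒪_X` as a
`ℤ`-algebra map — there is EXACTLY ONE `N ∈ G(k, Γ(X, U) ⊗_ℤ M; Γ(X, U))` restricting to `N_f` on every `D(f)`.
This is ★ `existsUnique_map_eq_of_map_eq` with `A = Γ(X, U)`, `B_f = Γ(X, D(f))` (a localization `A[1/f]`,
`IsAffineOpen.isLocalization_basicOpen`) and `B_{fg} = Γ(X, D(fg))` (`= B_f[1/g] = B_g[1/f]`, `isLocalization_of_eq_basicOpen` with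
`Scheme.basicOpen_res`, `Scheme.basicOpen_mul`).
[cite: GortzWedhorn2020, (8.4) (pp. 213–215) and (8.6) (p. 217)] [cite: StacksProject, Tag 089R] -/
theorem existsUnique_map_eq_of_map_eq_basicOpen
    (N : ∀ f : s, Module.Grassmannian Γ(X, X.basicOpen (f : Γ(X, U))) (Γ(X, X.basicOpen (f : Γ(X, U))) ⊗[ℤ] M) k)
    (hN : ∀ f g : s,
      Module.Grassmannian.map
          (X.presheaf.map (homOfLE (basicOpen_mul_le_left (f : Γ(X, U)) g)).op).hom.toIntAlgHom (N f) =
        Module.Grassmannian.map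
          (X.presheaf.map (homOfLE (basicOpen_mul_le_right (f : Γ(X, U)) g)).op).hom.toIntAlgHom (N g)) :
    ∃! N₀ : Module.Grassmannian Γ(X, U) (Γ(X, U) ⊗[ℤ] M) k,
      ∀ f : s, Module.Grassmannian.map (X.presheaf.map (homOfLE (X.basicOpen_le (f : Γ(X, U)))).op).hom.toIntAlgHom N₀ =
        N f := by
  classical
  -- the pieces `B_f = Γ(X, D(f))` are localizations `Γ(X, U)[1/f]`
  haveI hB : ∀ f : s, IsLocalization.Away (f : Γ(X, U)) Γ(X, X.basicOpen (f : Γ(X, U))) := fun f =>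
    hU.isLocalization_basicOpen _
  -- the restriction maps to the double overlaps, as `Γ(X, U)`-algebra maps
  let ψl : ∀ f g : s, Γ(X, X.basicOpen (f : Γ(X, U))) →ₐ[Γ(X, U)] Γ(X, X.basicOpen ((f : Γ(X, U)) * (g : Γ(X, U)))) := fun f g =>
    { toRingHom := (X.presheaf.map (homOfLE (basicOpen_mul_le_left (f : Γ(X, U)) g)).op).hom
      commutes' := fun x => by
        change (X.presheaf.map (homOfLE (X.basicOpen_le _)).op ≫ X.presheaf.map (homOfLE _).op) x = _
        rw [← X.presheaf.map_comp]
        rfl }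
  let ψr : ∀ f g : s, Γ(X, X.basicOpen (g : Γ(X, U))) →ₐ[Γ(X, U)] Γ(X, X.basicOpen ((f : Γ(X, U)) * (g : Γ(X, U)))) := fun f g =>
    { toRingHom := (X.presheaf.map (homOfLE (basicOpen_mul_le_right (f : Γ(X, U)) g)).op).hom
      commutes' := fun x => by
        change (X.presheaf.map (homOfLE (X.basicOpen_le _)).op ≫ X.presheaf.map (homOfLE _).op) x = _
        rw [← X.presheaf.map_comp]
        rfl }
  -- `Γ(X, D(fg)) = Γ(X, D(f))[1/g] = Γ(X, D(g))[1/f]`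
  have hl : ∀ f g : s, @IsLocalization _ _ (.powers (algebraMap Γ(X, U) Γ(X, X.basicOpen (f : Γ(X, U))) g))
      Γ(X, X.basicOpen ((f : Γ(X, U)) * (g : Γ(X, U)))) _ (ψl f g).toRingHom.toAlgebra := fun f g =>
    (hU.basicOpen (f : Γ(X, U))).isLocalization_of_eq_basicOpen _ (homOfLE (basicOpen_mul_le_left (f : Γ(X, U)) g))
      (by rw [RingHom.algebraMap_toAlgebra, Scheme.basicOpen_res]; exact X.basicOpen_mul _ _)
  have hr : ∀ f g : s, @IsLocalization _ _ (.powers (algebraMap Γ(X, U) Γ(X, X.basicOpen (g : Γ(X, U))) f))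
      Γ(X, X.basicOpen ((f : Γ(X, U)) * (g : Γ(X, U)))) _ (ψr f g).toRingHom.toAlgebra := fun f g =>
    (hU.basicOpen (g : Γ(X, U))).isLocalization_of_eq_basicOpen _ (homOfLE (basicOpen_mul_le_right (f : Γ(X, U)) g))
      (by rw [RingHom.algebraMap_toAlgebra, Scheme.basicOpen_res]; exact (X.basicOpen_mul _ _).trans (inf_comm _ _))
  -- the hypotheses and the conclusion of ★ `existsUnique_map_eq_of_map_eq`, with its maps identified with ours
  have hψl : ∀ f g : s, (ψl f g).restrictScalars ℤ =
      (X.presheaf.map (homOfLE (basicOpen_mul_le_left (f : Γ(X, U)) g)).op).hom.toIntAlgHom := fun f g =>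
    AlgHom.ext fun _ => rfl
  have hψr : ∀ f g : s, (ψr f g).restrictScalars ℤ =
      (X.presheaf.map (homOfLE (basicOpen_mul_le_right (f : Γ(X, U)) g)).op).hom.toIntAlgHom := fun f g =>
    AlgHom.ext fun _ => rfl
  have hι : ∀ f : s, IsScalarTower.toAlgHom ℤ Γ(X, U) Γ(X, X.basicOpen (f : Γ(X, U))) =
      (X.presheaf.map (homOfLE (X.basicOpen_le (f : Γ(X, U)))).op).hom.toIntAlgHom := fun f =>
    AlgHom.ext fun _ => rfl
  have key := existsUnique_map_eq_of_map_eq (R := ℤ) (M := M) (k := k) s hs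
    (fun f : s => Γ(X, X.basicOpen (f : Γ(X, U)))) (fun f g : s => Γ(X, X.basicOpen ((f : Γ(X, U)) * (g : Γ(X, U))))) ψl ψr hl hr N
    (fun f g => by rw [hψl, hψr]; exact hN f g)
  simpa only [hι] using key

include hU hs in
/-- Two Grassmannian elements over an affine open `U` with the same restriction to every `D(f)`, `f ∈ s` (`s` finite,
generating the unit ideal), are equal — the uniqueness half of ★ `existsUnique_map_eq_of_map_eq_basicOpen`.
[cite: GortzWedhorn2020, (8.4) (pp. 213–215) and (8.6) (p. 217)] -/
theorem eq_of_forall_map_basicOpen_eq (N₁ N₂ : Module.Grassmannian Γ(X, U) (Γ(X, U) ⊗[ℤ] M) k)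
    (h : ∀ f : s, Module.Grassmannian.map (X.presheaf.map (homOfLE (X.basicOpen_le (f : Γ(X, U)))).op).hom.toIntAlgHom N₁ =
      Module.Grassmannian.map (X.presheaf.map (homOfLE (X.basicOpen_le (f : Γ(X, U)))).op).hom.toIntAlgHom N₂) :
    N₁ = N₂ := by
  obtain ⟨N₀, -, huniq⟩ := existsUnique_map_eq_of_map_eq_basicOpen hU s hs
    (fun f : s => Module.Grassmannian.map (X.presheaf.map (homOfLE (X.basicOpen_le (f : Γ(X, U)))).op).hom.toIntAlgHom N₂)
    (fun f g => by rw [map_res_comp, map_res_comp])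
  exact (huniq N₁ h).trans (huniq N₂ fun _ => rfl).symm

end Gluing

end Literature.AlgebraicGeometry.Motives.Grassmannian
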